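import Literature.Analysis.FluidPDE.LinearisedNSFourierForcedData
import HarnessLib

/-!
# Synthesis of the solution of the linearised Navier–Stokes equation with a source: smoothness, dictionary, datum

Analysis/FluidPDE proof file, sixth of the files `LinearisedNSFourierForced*` (objects in
`LinearisedNSFourierForcedDefs`; the Fourier-side package in `LinearisedNSFourierForcedData`),
the inhomogeneous twin of `LinearisedNSFourierSynthesis`. For `ν > 0`, `T > 0`, a background
`u` jointly smooth and divergence free on `[0, T] × T^d`, a jointly smooth source `g` with
mean-zero slices and a smooth divergence-free mean-zero datum `w₀` (Constantin–Foias 1988,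
Ch. 14, (14.3)–(14.4) with an inhomogeneity), the coefficient field `c = solCoeffF ν T u g w₀`
and the synthesized fields satisfy (`synthF_spec`):

* the complex velocity components `Vₗ = velCF ν T u g w₀ l = ∑ₖ c(l,t,k) e_k` and the complex
  pressure `Q = presCF ν T u g w₀` are jointly smooth on `[0, T] × T^d`
  (`ScalarFourier.isSmoothSpaceTimeOn_torusSynth`: families of every order,
  `solCoeffF_spec`, `exists_presFamilyF`), hence so are their real parts `velF`, `presF`;
* the Fourier dictionary at `t ∈ [0, T]`: `𝓕(Vₗ) = cₗ` (all `t`),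
  `𝓕(∂ₜVₗ) = -νₖcₗ - (P linSym)ₗ + (P G)ₗ` (`ScalarFourier.timeDerivWithin_torusSynth` and the
  differentiated mild equation), `𝓕(Q) = q̂`;
* the datum: `Vₗ(0, x) = (w₀(x)ₗ : ℂ)` by pointwise Fourier inversion
  (`ScalarFourier.tsum_mFourierCoeff_mul_mFourier`, Grafakos 2014, §3.3.1), hence
  `velF ν T u g w₀ 0 = w₀`.

## References

* P. Constantin, C. Foias, *Navier–Stokes Equations*, Univ. Chicago Press 1988, Ch. 14, (14.3)–(14.4). [`ConstantinFoiasNSE1988`]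
* L. Grafakos, *Classical Fourier Analysis*, 3rd ed. (2014), Prop. 3.2.7, §3.3.1. [`Grafakos2014`]
-/

noncomputable section

open MeasureTheory Real Set Filter Topology UnitAddTorus

namespace Literature.Analysis.FluidPDE

namespace LinearisedNSFourier

open scoped ContDiff
open ScalarFourier
open CorrectorFourier (leraySym driftCoeff)
open FourierNS (HasDecay clamp)
open Literature.Analysis.FunctionSpaces.Torus (freqNormSq IsSmoothSpaceTimeOn IsSmooth)

variable {d : Type*} [Fintype d] [DecidableEq d]
variable {ν T : ℝ} {u g : ℝ → UnitAddTorus d → EuclideanSpace ℝ d}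
  {w₀ : UnitAddTorus d → EuclideanSpace ℝ d}

/-- **The synthesized fields of the solution of the forced linearised equation.** For `ν > 0`,
`T > 0`, a jointly smooth divergence-free background `u` on `[0, T] × T^d`, a jointly smooth
source `g` with mean-zero slices and a smooth divergence-free mean-zero datum `w₀`: the complex
velocity components `Vₗ = velCF ν T u g w₀ l` and the complex pressure `Q = presCF ν T u g w₀`
are jointly smooth on `[0, T] × T^d`, and so are the real velocity `velF ν T u g w₀` and
pressure `presF ν T u g w₀`; the Fourier coefficients are `𝓕(Vₗ(t)) = c(l,t,·)` (all `t`),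
`𝓕(∂ₜVₗ(t)) = -νₖ cₗ - (P linSym)ₗ + (P G)ₗ` and `𝓕(Q(t)) = q̂(t,·)` for `t ∈ [0, T]`
(Grafakos 2014, §3.3.1, Prop. 3.2.7); and the datum is attained, `Vₗ(0, x) = (w₀(x)ₗ : ℂ)`
(pointwise Fourier inversion), so `velF ν T u g w₀ 0 = w₀`. [folklore] -/
theorem synthF_spec (hν : 0 < ν) (hT : 0 < T) (hu : IsSmoothSpaceTimeOn (Icc 0 T) u)
    (hdiv : ∀ t ∈ Icc 0 T, FunctionSpaces.Torus.IsDivFree (u t)) (hg : IsSmoothSpaceTimeOn (Icc 0 T) g)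
    (hgmean : ∀ t ∈ Icc 0 T, FunctionSpaces.Torus.HasZeroMean (g t)) (hw₀ : IsSmooth w₀)
    (hw₀div : FunctionSpaces.Torus.IsDivFree w₀) (hw₀mean : FunctionSpaces.Torus.HasZeroMean w₀) :
    (∀ l, IsSmoothSpaceTimeOn (Icc 0 T) (velCF ν T u g w₀ l)) ∧
    IsSmoothSpaceTimeOn (Icc 0 T) (presCF ν T u g w₀) ∧
    IsSmoothSpaceTimeOn (Icc 0 T) (velF ν T u g w₀) ∧ IsSmoothSpaceTimeOn (Icc 0 T) (presF ν T u g w₀) ∧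
    (∀ l t k, mFourierCoeff (velCF ν T u g w₀ l t) k = solCoeffF ν T u g w₀ l t k) ∧
    (∀ l, ∀ t ∈ Icc 0 T, ∀ k,
      mFourierCoeff (FunctionSpaces.Torus.timeDerivWithin (Icc 0 T) (velCF ν T u g w₀ l) t) k =
      -(heatRate ν k : ℂ) * solCoeffF ν T u g w₀ l t k -
        linProjSym (fun j => driftCoeff T u j t) (fun j => solCoeffF ν T u g w₀ j t) l k +
        srcProj (fun j => driftCoeff T g j t) l k) ∧
    (∀ t ∈ Icc 0 T, ∀ k, mFourierCoeff (presCF ν T u g w₀ t) k = presCoeffFieldF ν T u g w₀ t k) ∧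
    (∀ l x, velCF ν T u g w₀ l 0 x = ((w₀ x l : ℝ) : ℂ)) ∧
    velF ν T u g w₀ 0 = w₀ := by
  obtain ⟨hcc, hdecay, hdivF, hzero, hdatum, hderiv, hfam⟩ :=
    solCoeffF_spec hν hT hu hdiv hg hgmean hw₀ hw₀div hw₀mean
  have hUS : UniqueDiffOn ℝ (Icc 0 T) := uniqueDiffOn_Icc hT
  -- summability of the coefficients at every time
  obtain ⟨C₀, -, hC₀⟩ := hdecay (latOrder d)
  have hsum : ∀ l t, Summable fun k => ‖solCoeffF ν T u g w₀ l t k‖ := fun l t =>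
    summable_norm_of_hasDecay le_rfl (hC₀ l t)
  -- smoothness of the complex fields
  have hV : ∀ l, IsSmoothSpaceTimeOn (Icc 0 T) (velCF ν T u g w₀ l) := fun l =>
    isSmoothSpaceTimeOn_torusSynth hT fun n => by
      obtain ⟨W, hW0, hW⟩ := hfam n
      exact ⟨W l, hW0 l, hW l⟩
  have hQ : IsSmoothSpaceTimeOn (Icc 0 T) (presCF ν T u g w₀) :=
    isSmoothSpaceTimeOn_torusSynth hT fun n => by
      obtain ⟨W, hW0, hW⟩ := hfam n
      exact exists_presFamilyF hT hu hg hW0 hW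
  -- smoothness of the real fields
  have hvel : IsSmoothSpaceTimeOn (Icc 0 T) (velF ν T u g w₀) := by
    change ContDiffOn ℝ ∞ (FunctionSpaces.Torus.stLift (velF ν T u g w₀)) (Icc 0 T ×ˢ univ)
    rw [contDiffOn_euclidean]
    intro l
    exact (hV l).clm_comp Complex.reCLM
  have hpres : IsSmoothSpaceTimeOn (Icc 0 T) (presF ν T u g w₀) := hQ.clm_comp Complex.reCLM
  -- the dictionary
  have hcV : ∀ l t k, mFourierCoeff (velCF ν T u g w₀ l t) k = solCoeffF ν T u g w₀ l t k := fun l t k =>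
    mFourierCoeff_tsum_mul_mFourier (hsum l t) k
  have hcVt : ∀ l, ∀ t ∈ Icc 0 T, ∀ k,
      mFourierCoeff (FunctionSpaces.Torus.timeDerivWithin (Icc 0 T) (velCF ν T u g w₀ l) t) k =
      -(heatRate ν k : ℂ) * solCoeffF ν T u g w₀ l t k -
        linProjSym (fun j => driftCoeff T u j t) (fun j => solCoeffF ν T u g w₀ j t) l k +
        srcProj (fun j => driftCoeff T g j t) l k := by
    intro l t ht k
    obtain ⟨W, hW0, hW⟩ := hfam 1
    have hW1 : ∀ m, W l 1 t m = -(heatRate ν m : ℂ) * solCoeffF ν T u g w₀ l t m -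
        linProjSym (fun j => driftCoeff T u j t) (fun j => solCoeffF ν T u g w₀ j t) l m +
        srcProj (fun j => driftCoeff T g j t) l m := by
      intro m
      have h1 := (hW l).deriv 0 (by norm_num) m t ht
      rw [hW0] at h1
      exact (h1.derivWithin (hUS t ht)).symm.trans ((hderiv l m t ht).derivWithin (hUS t ht))
    have hdt : ∀ x, FunctionSpaces.Torus.timeDerivWithin (Icc 0 T) (velCF ν T u g w₀ l) t x =
        torusSynth (W l 1) t x := by
      intro x
      have := timeDerivWithin_torusSynth hT (hW l) ht x
      rwa [hW0] at this
    obtain ⟨C1, -, hC1⟩ := (hW l).decay_nonneg le_rfl (latOrder d)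
    have hsum1 : Summable fun m => ‖W l 1 t m‖ := summable_norm_of_hasDecay le_rfl (hC1 t ht)
    have hfun : FunctionSpaces.Torus.timeDerivWithin (Icc 0 T) (velCF ν T u g w₀ l) t =
        fun x => ∑' m, W l 1 t m * mFourier m x := funext hdt
    rw [hfun, mFourierCoeff_tsum_mul_mFourier hsum1 k, hW1 k]
  have hcQ : ∀ t ∈ Icc 0 T, ∀ k, mFourierCoeff (presCF ν T u g w₀ t) k = presCoeffFieldF ν T u g w₀ t k := by
    intro t ht k
    obtain ⟨W, hW0, hW⟩ := hfam 0
    obtain ⟨Qf, hQ0, hQf⟩ := exists_presFamilyF hT hu hg hW0 hW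
    obtain ⟨C0, -, hC0'⟩ := hQf.decay_nonneg le_rfl (latOrder d)
    have hsumQ : Summable fun m => ‖presCoeffFieldF ν T u g w₀ t m‖ := by
      have := summable_norm_of_hasDecay le_rfl (hC0' t ht)
      rwa [hQ0] at this
    exact mFourierCoeff_tsum_mul_mFourier hsumQ k
  -- the datum
  have hV0 : ∀ l x, velCF ν T u g w₀ l 0 x = ((w₀ x l : ℝ) : ℂ) := by
    intro l x
    have hgs : IsSmooth (fun y => ((w₀ y l : ℝ) : ℂ)) := isSmooth_datumComp hw₀ l
    change (∑' k, solCoeffF ν T u g w₀ l 0 k * mFourier k x) = _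
    have hc0 : solCoeffF ν T u g w₀ l 0 = datumCoeff w₀ l := funext fun k => hdatum l k
    rw [hc0]
    exact tsum_mFourierCoeff_mul_mFourier hgs.continuous (summable_norm_mFourierCoeff hgs) x
  refine ⟨hV, hQ, hvel, hpres, hcV, hcVt, hcQ, hV0, ?_⟩
  funext x
  ext l
  rw [velF_apply, hV0 l x, Complex.ofReal_re]

end LinearisedNSFourier

end Literature.Analysis.FluidPDE

end
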